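import Literature.NumberTheory.EllipticCurves.BurungaleKobayashiNakamuraOta2026.SignedSelmerMainIdentity
import Literature.NumberTheory.EllipticCurves.Kato2004.MainConjectureSkeletonProofs
import Literature.NumberTheory.EllipticCurves.SkinnerUrban2014.CharacteristicIdealBaseChangeProofs
import HarnessLib

/-!
# Burungale–Kobayashi–Nakamura–Ota 2026, proof of Thm. 5.6 ((5.3)–(5.4)): on the signed skeleton,
# the SIGNED main identity `Ch(X^{−ε}) = (L_{p,v_ε})` and the ELLIPTIC-UNIT main identity
# `Ch(X^ac_str) = Ch(𝒮^ac_rel/Λ z)` (Thm. 3.14 (3)) are interchangeable — PROVED, prime by prime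
# (theorems only; no definition of an object, no named fact; companion of `SignedSelmerMainIdentity.lean`)

Topic `NumberTheory/EllipticCurves/BurungaleKobayashiNakamuraOta2026`.  The companion file types the
`Λ_ac`-module skeleton `SignedSkeleton` of [BKNO] §5 and the printed statements as predicates
(`Prop37Shape`, `Thm314Shape`, `Thm55Shape`, `SignedMainIdentity`), and records (its docstring,
"(ii)") the observation legible from the proof of Thm. 5.6 that, GIVEN the skeleton, the signed
identity is equivalent to the elliptic-unit identity, leaving the kernel proof as a `TODO` ("needs
`Ch_Λ`-multiplicativity on short exact sequences").  This file discharges that TODO in the additive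
(local-length) currency of the tree, by RE-USING the kernel theorems written for the same shape of
argument in Kato 2004 §17.13 (`Kato2004.lengthAt_skeleton_identity`, `isTorsion_of_skeleton`,
`isTorsionBy_quotient_of_skeleton`; `Module.charIdeal_eq_span_of_lengthAt_eq_quotient`): BKNO's
(5.1)/(5.3) `𝒮^ac_rel ↪ H_𝔭/H_{−ε} → X^{−ε} → X^ac_str → 0` IS Kato's (17.13.1)
`𝐇¹ ↪ 𝐇¹_loc/𝐇¹_f → 𝔛 → 𝐇² → 𝐇²_loc` with `𝐇²_loc = 0`, the Coleman map replaced by the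
coordinate `H_𝔭/H_{−ε} ≅ H_ε ≅ Λ` in the basis `v_ε`, the zeta elements by `Λ·z^{t,ac}_{p^∞𝔣}`,
and `L_{p-adic}` by `L_{p,v_ε,t}(φ)`.

## The printed proof being formalised (arXiv:2608.06879v1, PDF pp. 56–57 = printed pp. 34–35)

> "Proof [of Thm. 5.6]. By Theorem 5.5, we have an exact sequence
> (5.3) `0 → S^ac_rel → H¹_ε(K_𝔭, T^{⊗−1}(1) ⊗ Λ_ac) → X^{−ε} → X^ac_str → 0`.
> Hence (5.4) `Ch_{Λac}(X^{−ε}) = Ch_{Λac}(X^ac_str) · Ch_{Λac}(H¹_ε(…)/S^ac_rel)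
> = Ch_{Λac}(S^ε/Λ_ac z^{t,ac}_{p^∞𝔣}) · Ch_{Λac}(H¹_ε(…)/S^ε)`, where the second equality follows
> from Theorem 3.14 and Theorem 5.5 […] and the fact `Ch_{Λac}(H¹_ε(K_𝔭, …)/Λ_ac loc_p(z)) =
> (L_{p,v_ε,t}(φ))`, the latter being immediate from Definition 4.7."

Additively, at a prime `𝔭` of `Λ`, with `ℓ = length_{Λ_𝔭}((−)_𝔭)`, the exact sequence gives the
UNCONDITIONAL identity (`lengthAt_identity`, every commutative `Λ`, no finiteness input)
`ℓ(X^{−ε}) + ℓ(𝒮^ac_rel/Λz) = ℓ(Λ/(L)) + ℓ(X^ac_str)`,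
whence at every prime of height `≤ 1` of a Noetherian domain (both auxiliary lengths finite):
`ℓ(X^ac_str) = ℓ(𝒮^ac_rel/Λz) ⟺ ℓ(X^{−ε}) = ℓ(Λ/(L))` (`lengthAt_thm314_iff_thm56`) — Thm. 3.14 (3)
at `𝔭` versus Thm. 5.6 (2) at `𝔭`; and over a Noetherian UFD (the paper's `Λ_ac = 𝒪[[Γ^ac]] ≅
𝒪⟦T⟧`) the length form of Thm. 3.14 (3) at every height-one prime yields `SignedMainIdentity`
ITSELF — `X^{−ε}` torsion and `Ch_Λ(X^{−ε}) = (L) = LpIdeal` (`signedMainIdentity_of_lengthAt_thm314`);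
conversely the length form of Thm. 5.6 (2) yields `Thm314Shape` (`thm314Shape_of_lengthAt_thm56`).

## Hypotheses, and what is NOT claimed

Inputs, all as in print: the skeleton's exact sequence (5.1) (fields), `S^{−ε} = 0` (Thm. 5.5 (2):
`negPreimage = ⊥`, making `𝒮^ac_rel → H_𝔭/H_{−ε}` injective), a basis `v` of `H_ε` with
`loc_𝔭 z = L·v` (`IsLpOf v L`, §1.2.3 / Def. 4.7; existence from the skeleton's `free_Hε`,
`finrank_Hε`, `loc_z_mem`: `exists_isLpOf`), `L ≠ 0` (Prop. 3.7 (1)), `X^ac_str` torsion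
(Prop. 3.7 (2)) and `𝒮^ac_rel` finitely generated.  The passage between the CHARACTERISTIC-IDEAL
forms `Thm314Shape ↔ SignedMainIdentity` needs "equal characteristic ideals of f.g. torsion modules
over a UFD have equal height-one lengths", which the tree does not have; the equivalence is therefore
proved in the prime-by-prime length currency (which implies the ideal currency, not conversely).
Nothing here asserts any field of the skeleton or any of the printed theorems: every statement is
relative to `D : SignedSkeleton …` and hypotheses named in it.  The paper is a PREPRINT; these are
kernel facts about its proof skeleton, not an endorsement.

References: [BurungaleKobayashiNakamuraOta2026] arXiv:2608.06879v1 Thm. 5.5, Thm. 5.6 and its proof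
(5.1)–(5.4) (PDF pp. 55–57), Prop. 3.7, Thm. 3.14 (3), Def. 4.7, §1.2.3; [Kato2004Asterisque] §17.13
(p. 280) (the length identity re-used); [Washington1997] §13.2 (characteristic ideals).
-/

noncomputable section

open scoped Classical

namespace Literature.NumberTheory.EllipticCurves.BurungaleKobayashiNakamuraOta2026.SignedSkeleton

variable {Λ : Type*} [CommRing Λ] {Hp Srel Xneg Xstr : Type*} [AddCommGroup Hp]
  [_root_.Module Λ Hp] [AddCommGroup Srel] [_root_.Module Λ Srel] [AddCommGroup Xneg]
  [_root_.Module Λ Xneg] [AddCommGroup Xstr] [_root_.Module Λ Xstr]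
  (D : SignedSkeleton Λ Hp Srel Xneg Xstr)

/-! ## The maps of (5.1) on the skeleton -/

/-- The first map of (5.1): `𝒮^ac_rel →(loc_𝔭 mod H_{−ε}) H_𝔭/H_{−ε}`.
[claim: BurungaleKobayashiNakamuraOta2026, status: under-review] -/
def locQuot : Srel →ₗ[Λ] Hp ⧸ D.Hnegε :=
  D.Hnegε.mkQ ∘ₗ D.loc

/-- Unfolding `locQuot`. [claim: BurungaleKobayashiNakamuraOta2026, status: under-review] -/
@[simp] theorem locQuot_apply (s : Srel) : D.locQuot s = D.Hnegε.mkQ (D.loc s) := rfl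

/-- `loc_𝔭(s) ≡ 0 mod H_{−ε}` iff `s ∈ S^{−ε} = loc⁻¹(H_{−ε})`.
[claim: BurungaleKobayashiNakamuraOta2026, status: under-review] -/
theorem locQuot_eq_zero_iff (s : Srel) : D.locQuot s = 0 ↔ s ∈ D.negPreimage := by
  rw [locQuot_apply, Submodule.mkQ_apply, Submodule.Quotient.mk_eq_zero]
  rfl

/-- `S^{−ε} = 0` (Thm. 5.5 (2)) makes the first map of (5.1) injective — the left end of (5.3).
[claim: BurungaleKobayashiNakamuraOta2026, status: under-review] -/
theorem locQuot_injective (hneg : D.negPreimage = ⊥) : Function.Injective D.locQuot := by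
  rw [← LinearMap.ker_eq_bot, eq_bot_iff]
  intro s hs
  rw [LinearMap.mem_ker, locQuot_eq_zero_iff, hneg] at hs
  exact hs

/-- Exactness of (5.1) at `H_𝔭/H_{−ε}` (skeleton field `exact_quot`).
[claim: BurungaleKobayashiNakamuraOta2026, status: under-review] -/
theorem exact_locQuot_toXneg : Function.Exact D.locQuot D.toXneg :=
  LinearMap.exact_iff.mpr D.exact_quot

/-- Exactness of (5.1) at `X^{−ε}` (skeleton field `exact_Xneg`).
[claim: BurungaleKobayashiNakamuraOta2026, status: under-review] -/
theorem exact_toXneg_toXstr : Function.Exact D.toXneg D.toXstr :=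
  LinearMap.exact_iff.mpr D.exact_Xneg

/-- Exactness of (5.1) at `X^ac_str`: `X^{−ε} → X^ac_str → 0` (skeleton field `toXstr_surjective`),
written as exactness towards the zero module (Kato's `𝐇²_loc`, here `0`).
[claim: BurungaleKobayashiNakamuraOta2026, status: under-review] -/
theorem exact_toXstr_zero : Function.Exact D.toXstr (0 : Xstr →ₗ[Λ] PUnit) :=
  fun x => iff_of_true (Subsingleton.elim _ _) (D.toXstr_surjective x)

/-! ## The coordinate of `H_𝔭/H_{−ε} ≅ H_ε ≅ Λ` in a basis `v_ε` (Def. 4.7) -/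

section Basis

variable {D} {v : Hp} {L : Λ}

/-- The image `v̄` of a basis `v` of `H_ε` generates `H_𝔭/H_{−ε}` (`H_𝔭 = H_ε ⊕ H_{−ε}`).
[claim: BurungaleKobayashiNakamuraOta2026, status: under-review] -/
theorem span_mkQ_eq_top (hv : D.IsLpOf v L) : Submodule.span Λ {D.Hnegε.mkQ v} = ⊤ := by
  have h1 : Submodule.map D.Hnegε.mkQ D.Hε = ⊤ := by
    rw [Submodule.map_mkQ_eq_top]
    exact D.isCompl.symm.sup_eq_top
  rwa [← hv.1, Submodule.map_span, Set.image_singleton] at h1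

/-- `v̄` is torsion-free in `H_𝔭/H_{−ε}`: `a·v ∈ H_{−ε} ∩ H_ε = 0` forces `a = 0`.
[claim: BurungaleKobayashiNakamuraOta2026, status: under-review] -/
theorem eq_zero_of_smul_mkQ_eq_zero (hv : D.IsLpOf v L) (a : Λ) (ha : a • D.Hnegε.mkQ v = 0) :
    a = 0 := by
  rw [← map_smul, Submodule.mkQ_apply, Submodule.Quotient.mk_eq_zero] at ha
  have hε : a • v ∈ D.Hε := by
    rw [← hv.1]
    exact Submodule.smul_mem _ _ (Submodule.mem_span_singleton_self v)
  exact hv.2.1 a ((Submodule.disjoint_def.mp D.isCompl.disjoint) _ hε ha)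

variable (D) in
/-- **The coordinate isomorphism `Λ ⥲ H_𝔭/H_{−ε}`, `a ↦ a·v̄`**, for a basis `v` of `H_ε` — the
identification `H¹_ε(K_𝔭, T^{⊗−1}(1) ⊗ Λ_ac) = Λ_ac · v_ε` behind Def. 4.7; its inverse plays the
part of Kato's Coleman map `col` (with trivial cokernel).
[claim: BurungaleKobayashiNakamuraOta2026, status: under-review] -/
def coordEquiv (hv : D.IsLpOf v L) : Λ ≃ₗ[Λ] Hp ⧸ D.Hnegε :=
  LinearEquiv.ofBijective (LinearMap.toSpanSingleton Λ (Hp ⧸ D.Hnegε) (D.Hnegε.mkQ v))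
    ⟨(injective_iff_map_eq_zero _).mpr fun a ha =>
        eq_zero_of_smul_mkQ_eq_zero hv a (by simpa using ha),
      fun q => by
        have hq : q ∈ Submodule.span Λ {D.Hnegε.mkQ v} := by rw [span_mkQ_eq_top hv]; trivial
        obtain ⟨a, rfl⟩ := Submodule.mem_span_singleton.mp hq
        exact ⟨a, rfl⟩⟩

/-- `coordEquiv a = a·v̄`. [claim: BurungaleKobayashiNakamuraOta2026, status: under-review] -/
@[simp] theorem coordEquiv_apply (hv : D.IsLpOf v L) (a : Λ) :
    D.coordEquiv hv a = a • D.Hnegε.mkQ v := rfl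

/-- **`loc_𝔭(z) = L·v_ε` read in coordinates: the coordinate of `loc_𝔭 z mod H_{−ε}` is `L`**
(Def. 4.7 / §1.2.3). [claim: BurungaleKobayashiNakamuraOta2026, status: under-review] -/
theorem coordEquiv_symm_locQuot_z (hv : D.IsLpOf v L) :
    (D.coordEquiv hv).symm.toLinearMap (D.locQuot D.z) = L := by
  rw [LinearEquiv.coe_toLinearMap, LinearEquiv.symm_apply_eq, coordEquiv_apply, locQuot_apply,
    hv.2.2, map_smul]

/-- The image of `Λ·z` under `coordinate ∘ (loc_𝔭 mod H_{−ε})` is the ideal `(L)`.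
[claim: BurungaleKobayashiNakamuraOta2026, status: under-review] -/
theorem map_map_span_z (hv : D.IsLpOf v L) :
    ((Submodule.span Λ {D.z}).map D.locQuot).map (D.coordEquiv hv).symm.toLinearMap =
      Ideal.span {L} := by
  rw [Submodule.map_span, Submodule.map_span, Set.image_singleton, Set.image_singleton,
    coordEquiv_symm_locQuot_z hv]

/-- `L ∈ (coordinate ∘ loc)(Λ·z)`. [claim: BurungaleKobayashiNakamuraOta2026, status: under-review] -/
theorem mem_map_span_z (hv : D.IsLpOf v L) :
    L ∈ Submodule.map ((D.coordEquiv hv).symm.toLinearMap ∘ₗ D.locQuot) (Submodule.span Λ {D.z}) :=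
  Submodule.mem_map.mpr ⟨D.z, Submodule.mem_span_singleton_self _,
    by rw [LinearMap.comp_apply, coordEquiv_symm_locQuot_z hv]⟩

/-- **A basis exists**: `H_ε` free of rank one (skeleton fields `free_Hε`, `finrank_Hε`) and
`loc_𝔭 z ∈ H_ε` (Prop. 4.6, field `loc_z_mem`) give some `v`, `L` with `IsLpOf v L` — "fix a basis
`v_ε` of `H¹_ε(Ψ, T_φ)` … `loc_p(z) = L_{p,v_ε} · v_ε`" (§1.2.3).
[claim: BurungaleKobayashiNakamuraOta2026, status: under-review] -/
theorem exists_isLpOf [Nontrivial Λ] (D : SignedSkeleton Λ Hp Srel Xneg Xstr) :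
    ∃ (v : Hp) (L : Λ), D.IsLpOf v L := by
  haveI := D.free_Hε
  haveI : Module.Finite Λ D.Hε := Module.finite_of_finrank_pos (by rw [D.finrank_Hε]; exact one_pos)
  let b := Module.finBasisOfFinrankEq Λ D.Hε D.finrank_Hε
  refine ⟨(b 0 : Hp), ?_⟩
  have hspan : Submodule.span Λ {((b 0 : D.Hε) : Hp)} = D.Hε := by
    have hb : Submodule.span Λ (Set.range b) = ⊤ := b.span_eq
    have hr : Set.range b = {b 0} := by
      ext x
      simp only [Set.mem_range, Set.mem_singleton_iff]
      constructor
      · rintro ⟨i, rfl⟩; rw [Subsingleton.elim i 0]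
      · rintro rfl; exact ⟨0, rfl⟩
    rw [hr] at hb
    apply le_antisymm
    · rw [Submodule.span_le, Set.singleton_subset_iff]; exact (b 0).2
    · intro x hx
      have hx' : (⟨x, hx⟩ : D.Hε) ∈ Submodule.span Λ {b 0} := by rw [hb]; trivial
      obtain ⟨a, ha⟩ := Submodule.mem_span_singleton.mp hx'
      exact Submodule.mem_span_singleton.mpr ⟨a, by simpa using congrArg Subtype.val ha⟩
  have hz : D.loc D.z ∈ Submodule.span Λ {((b 0 : D.Hε) : Hp)} := by rw [hspan]; exact D.loc_z_mem
  obtain ⟨L, hL⟩ := Submodule.mem_span_singleton.mp hz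
  refine ⟨L, hspan, fun a ha => ?_, hL.symm⟩
  have ha' : a • b 0 = 0 := Subtype.ext (by simpa using ha)
  simpa using (Fintype.linearIndependent_iff.mp b.linearIndependent (fun _ => a)
    (by simpa using ha')) 0

end Basis

/-! ## (5.4), additively: the length identity and the prime-by-prime equivalence -/

/-- `Λ/(G)` is killed by `G`. [folklore] -/
private theorem isTorsionBy_quotient_span_singleton (G : Λ) :
    Module.IsTorsionBy Λ (Λ ⧸ Ideal.span {G}) G := by
  intro q
  obtain ⟨y, rfl⟩ := Submodule.Quotient.mk_surjective _ q
  rw [← Submodule.Quotient.mk_smul, Submodule.Quotient.mk_eq_zero, smul_eq_mul]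
  exact Ideal.mul_mem_right y _ (Ideal.mem_span_singleton_self G)

/-- **(5.4), additively and unconditionally: at every prime `𝔭` of `Λ`,
`ℓ(X^{−ε})_𝔭 + ℓ(𝒮^ac_rel/Λz)_𝔭 = ℓ(Λ/(L))_𝔭 + ℓ(X^ac_str)_𝔭`** (`ℓ` = length of the
localisation), for a skeleton with `S^{−ε} = 0` and a basis `v` of `H_ε` with `loc_𝔭 z = L·v`.
This is Kato's §17.13 identity (`Kato2004.lengthAt_skeleton_identity`) for the sequence (5.1) =
`𝒮^ac_rel ↪ H_𝔭/H_{−ε} → X^{−ε} → X^ac_str → 0`, the coordinate `H_𝔭/H_{−ε} ≅ Λ` and `Z = Λz`;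
the two middle equalities of (5.4) (`Ch` multiplicative along (5.3) and along
`0 → 𝒮_rel/Λz → H_ε/Λ loc z → H_ε/𝒮_rel → 0`, `H_ε/Λ loc z ≅ Λ/(L)`) are its content.
[claim: BurungaleKobayashiNakamuraOta2026, status: under-review]
[cite: Kato2004Asterisque, §17.13 (p. 280), the length identity] -/
theorem lengthAt_identity {v : Hp} {L : Λ} (hneg : D.negPreimage = ⊥) (hv : D.IsLpOf v L)
    (𝔭 : PrimeSpectrum Λ) :
    Module.lengthAt Λ Xneg 𝔭 + Module.lengthAt Λ (Srel ⧸ Submodule.span Λ {D.z}) 𝔭 =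
      Module.lengthAt Λ (Λ ⧸ Ideal.span {L}) 𝔭 + Module.lengthAt Λ Xstr 𝔭 := by
  have h := Kato2004.lengthAt_skeleton_identity D.locQuot (D.locQuot_injective hneg) D.toXneg
    D.toXstr (0 : Xstr →ₗ[Λ] PUnit) D.exact_locQuot_toXneg D.exact_toXneg_toXstr
    D.exact_toXstr_zero (D.coordEquiv hv).symm.toLinearMap (D.coordEquiv hv).symm.injective
    (Submodule.span Λ {D.z}) 𝔭
  have hcol : Module.lengthAt Λ (Λ ⧸ LinearMap.range (D.coordEquiv hv).symm.toLinearMap) 𝔭 = 0 := by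
    haveI : Subsingleton (Λ ⧸ LinearMap.range (D.coordEquiv hv).symm.toLinearMap) :=
      Submodule.Quotient.subsingleton_iff.mpr
        (LinearMap.range_eq_top.mpr (D.coordEquiv hv).symm.surjective)
    exact Module.lengthAt_eq_zero_of_subsingleton 𝔭
  have hε : Module.lengthAt Λ (LinearMap.range (0 : Xstr →ₗ[Λ] PUnit)) 𝔭 = 0 := by
    rw [LinearMap.range_zero]
    exact Module.lengthAt_eq_zero_of_subsingleton 𝔭
  rw [hcol, hε, add_zero, add_zero, map_map_span_z hv] at h
  exact h

/-- `𝒮^ac_rel/Λz` is killed by `L` (`L·s` and `coord(loc s)·z` have the same coordinate).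
[claim: BurungaleKobayashiNakamuraOta2026, status: under-review] -/
theorem isTorsionBy_quotient_span_z {v : Hp} {L : Λ} (hneg : D.negPreimage = ⊥)
    (hv : D.IsLpOf v L) : Module.IsTorsionBy Λ (Srel ⧸ Submodule.span Λ {D.z}) L :=
  Kato2004.isTorsionBy_quotient_of_skeleton D.locQuot (D.locQuot_injective hneg)
    (D.coordEquiv hv).symm.toLinearMap (D.coordEquiv hv).symm.injective _ (mem_map_span_z hv)

/-- **Thm. 3.14 (3) at `𝔭` ⟺ Thm. 5.6 (2) at `𝔭`, for every prime `𝔭` of height `≤ 1` of a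
Noetherian domain `Λ`:** `ℓ(X^ac_str)_𝔭 = ℓ(𝒮^ac_rel/Λz)_𝔭 ↔ ℓ(X^{−ε})_𝔭 = ℓ(Λ/(L))_𝔭 = ord_𝔭 L`
— from `lengthAt_identity`, both auxiliary lengths being finite (`𝒮^ac_rel/Λz` and `Λ/(L)` are
finitely generated and killed by `L ≠ 0`).  Hypotheses: `S^{−ε} = 0` (Thm. 5.5 (2)), a basis `v` of
`H_ε` with `loc_𝔭 z = L·v` (Def. 4.7), `L ≠ 0` (Prop. 3.7 (1)), `𝒮^ac_rel` finitely generated.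
This is the kernel form of "(5.4) […] where the second equality follows from Theorem 3.14 and
Theorem 5.5", read in both directions. [claim: BurungaleKobayashiNakamuraOta2026, status: under-review] -/
theorem lengthAt_thm314_iff_thm56 [IsNoetherianRing Λ] [IsDomain Λ] [Module.Finite Λ Srel]
    {v : Hp} {L : Λ} (hneg : D.negPreimage = ⊥) (hv : D.IsLpOf v L) (hL : L ≠ 0)
    (𝔭 : PrimeSpectrum Λ) (h𝔭 : 𝔭.asIdeal.height ≤ 1) :
    Module.lengthAt Λ Xstr 𝔭 = Module.lengthAt Λ (Srel ⧸ Submodule.span Λ {D.z}) 𝔭 ↔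
      Module.lengthAt Λ Xneg 𝔭 = Module.lengthAt Λ (Λ ⧸ Ideal.span {L}) 𝔭 := by
  have h := D.lengthAt_identity hneg hv 𝔭
  have hfinZ : Module.lengthAt Λ (Srel ⧸ Submodule.span Λ {D.z}) 𝔭 ≠ ⊤ :=
    Module.lengthAt_ne_top_of_isTorsionBy hL (D.isTorsionBy_quotient_span_z hneg hv) 𝔭 h𝔭
  have hfinL : Module.lengthAt Λ (Λ ⧸ Ideal.span {L}) 𝔭 ≠ ⊤ :=
    Module.lengthAt_ne_top_of_isTorsionBy hL (isTorsionBy_quotient_span_singleton L) 𝔭 h𝔭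
  constructor
  · intro h314
    rw [h314] at h
    exact (add_left_inj_of_ne_top hfinZ).mp h
  · intro h56
    rw [h56] at h
    exact ((add_right_inj_of_ne_top hfinL).mp h).symm

/-! ## Over a Noetherian UFD (`Λ_ac = 𝒪[[Γ^ac]]`): the characteristic-ideal conclusions -/

/-- **Thm. 3.14 (3), prime by prime ⟹ Thm. 1.7 = Thm. 5.6 (2) with Thm. 5.5 (2): the SIGNED main
identity `SignedMainIdentity` (`X^{−ε}` torsion and `Ch_Λ(X^{−ε}) = (L_{p,v_ε}) = LpIdeal`)**, over a
Noetherian UFD `Λ`, for a skeleton with `S^{−ε} = 0` (Thm. 5.5 (2)), `X^ac_str` torsion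
(Prop. 3.7 (2)), a basis `v` of `H_ε` with `loc_𝔭 z = L·v`, `L ≠ 0` (Prop. 3.7 (1)), `𝒮^ac_rel` finitely
generated, GIVEN the elliptic-unit identity in length form at every height-one prime
(`ℓ(X^ac_str)_𝔭 = ℓ(𝒮^ac_rel/Λz)_𝔭`, the prime-by-prime content of Thm. 3.14 (3)).  Proof = the
printed (5.3)–(5.4): torsion by `Kato2004.isTorsion_of_skeleton`, the ideal by
`Module.charIdeal_eq_span_of_lengthAt_eq_quotient` and `lengthAt_thm314_iff_thm56`, and
`(L) = LpIdeal` by `LpIdeal_eq_span_of_isLpOf`. [claim: BurungaleKobayashiNakamuraOta2026, status: under-review] -/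
theorem signedMainIdentity_of_lengthAt_thm314 [IsNoetherianRing Λ] [IsDomain Λ]
    [UniqueFactorizationMonoid Λ] [Module.Finite Λ Srel] {v : Hp} {L : Λ}
    (hneg : D.negPreimage = ⊥) (hXstr : Module.IsTorsion Λ Xstr) (hv : D.IsLpOf v L) (hL : L ≠ 0)
    (h314 : ∀ 𝔭 : PrimeSpectrum Λ, 𝔭.asIdeal.height = 1 →
      Module.lengthAt Λ Xstr 𝔭 = Module.lengthAt Λ (Srel ⧸ Submodule.span Λ {D.z}) 𝔭) :
    D.SignedMainIdentity := by
  refine ⟨Kato2004.isTorsion_of_skeleton D.locQuot D.toXneg D.toXstr D.exact_locQuot_toXneg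
      D.exact_toXneg_toXstr (D.coordEquiv hv).symm.toLinearMap (D.coordEquiv hv).symm.injective hL
      (coordEquiv_symm_locQuot_z hv) hXstr, ?_⟩
  rw [D.LpIdeal_eq_span_of_isLpOf hv]
  exact Module.charIdeal_eq_span_of_lengthAt_eq_quotient hL fun 𝔭 h1 =>
    (D.lengthAt_thm314_iff_thm56 hneg hv hL 𝔭 h1.le).mp (h314 𝔭 h1)

/-- The same, with the printed hypothesis packages: `Prop37Shape` (supplying `loc_𝔭 z` non-torsion,
hence `L ≠ 0`, and `X^ac_str` torsion) and `Thm55Shape` (supplying `S^{−ε} = 0`), a basis `(v, L)`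
of `H_ε`, and Thm. 3.14 (3) in length form at every height-one prime.
[claim: BurungaleKobayashiNakamuraOta2026, status: under-review] -/
theorem signedMainIdentity_of_prop37_thm55_lengthAt_thm314 [IsNoetherianRing Λ] [IsDomain Λ]
    [UniqueFactorizationMonoid Λ] [Module.Finite Λ Srel] {v : Hp} {L : Λ}
    (h37 : D.Prop37Shape) (h55 : D.Thm55Shape) (hv : D.IsLpOf v L)
    (h314 : ∀ 𝔭 : PrimeSpectrum Λ, 𝔭.asIdeal.height = 1 →
      Module.lengthAt Λ Xstr 𝔭 = Module.lengthAt Λ (Srel ⧸ Submodule.span Λ {D.z}) 𝔭) :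
    D.SignedMainIdentity := by
  have hL : L ≠ 0 := by
    intro hL0
    have h0 : (1 : Λ) • D.loc D.z = 0 := by rw [hv.2.2, hL0, zero_smul, smul_zero]
    exact one_ne_zero (h37.1 1 h0)
  exact D.signedMainIdentity_of_lengthAt_thm314 h55.2.1 h37.2.1 hv hL h314

/-- **Conversely: Thm. 5.6 (2) prime by prime ⟹ Thm. 3.14 (3)** (`Thm314Shape`:
`Ch(X^ac_str) = Ch(𝒮^ac_rel/Λz)`), over a Noetherian domain, for a skeleton with `S^{−ε} = 0`, a
basis `(v, L)` of `H_ε` with `L ≠ 0` and `𝒮^ac_rel` finitely generated: the length form of the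
signed identity at every height-one prime gives the length form of the elliptic-unit identity there
(`lengthAt_thm314_iff_thm56`), hence equal characteristic ideals (`Module.charIdeal_eq_of_lengthAt_eq`).
[claim: BurungaleKobayashiNakamuraOta2026, status: under-review] -/
theorem thm314Shape_of_lengthAt_thm56 [IsNoetherianRing Λ] [IsDomain Λ] [Module.Finite Λ Srel]
    {v : Hp} {L : Λ} (hneg : D.negPreimage = ⊥) (hv : D.IsLpOf v L) (hL : L ≠ 0)
    (h56 : ∀ 𝔭 : PrimeSpectrum Λ, 𝔭.asIdeal.height = 1 →
      Module.lengthAt Λ Xneg 𝔭 = Module.lengthAt Λ (Λ ⧸ Ideal.span {L}) 𝔭) :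
    D.Thm314Shape :=
  Module.charIdeal_eq_of_lengthAt_eq fun 𝔭 h1 =>
    (D.lengthAt_thm314_iff_thm56 hneg hv hL 𝔭 h1.le).mpr (h56 𝔭 h1)

/-- And the length form of Thm. 3.14 (3) gives `Thm314Shape` (trivially, `char` being the product
of the height-one lengths). [claim: BurungaleKobayashiNakamuraOta2026, status: under-review] -/
theorem thm314Shape_of_lengthAt_thm314
    (h314 : ∀ 𝔭 : PrimeSpectrum Λ, 𝔭.asIdeal.height = 1 →
      Module.lengthAt Λ Xstr 𝔭 = Module.lengthAt Λ (Srel ⧸ Submodule.span Λ {D.z}) 𝔭) :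
    D.Thm314Shape :=
  Module.charIdeal_eq_of_lengthAt_eq h314

/-- Summary over a Noetherian UFD with the printed packages `Prop37Shape`, `Thm55Shape` and a basis
`(v, L)`: the length form of Thm. 3.14 (3) at every height-one prime delivers BOTH printed
main identities on the skeleton — the elliptic-unit one (`Thm314Shape`, the (R-EU) input of the K7r
descent) and the signed one (`SignedMainIdentity`, Thm. 1.7) — so for the ladder Thm. 1.7 adds the
`p`-adic `L`-function packaging of Thm. 3.14, not new arithmetic input (companion docstring, (ii)).
[claim: BurungaleKobayashiNakamuraOta2026, status: under-review] -/
theorem thm314Shape_and_signedMainIdentity_of_lengthAt_thm314 [IsNoetherianRing Λ] [IsDomain Λ]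
    [UniqueFactorizationMonoid Λ] [Module.Finite Λ Srel] {v : Hp} {L : Λ}
    (h37 : D.Prop37Shape) (h55 : D.Thm55Shape) (hv : D.IsLpOf v L)
    (h314 : ∀ 𝔭 : PrimeSpectrum Λ, 𝔭.asIdeal.height = 1 →
      Module.lengthAt Λ Xstr 𝔭 = Module.lengthAt Λ (Srel ⧸ Submodule.span Λ {D.z}) 𝔭) :
    D.Thm314Shape ∧ D.SignedMainIdentity :=
  ⟨D.thm314Shape_of_lengthAt_thm314 h314,
    D.signedMainIdentity_of_prop37_thm55_lengthAt_thm314 h37 h55 hv h314⟩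

/-! ## Appended (same seat): the characteristic-IDEAL currency — `SignedMainIdentity ↔ Thm314Shape`

With `SkinnerUrban2014.lengthAt_eq_of_charIdeal_eq` (over a Noetherian UFD the characteristic
ideal of a finite torsion module determines its height-one lengths) the prime-by-prime equivalence
above becomes the equivalence of the two printed identities AS TYPED (equalities of `Ch_Λ`), on any
skeleton satisfying the printed packages `Prop37Shape` (Prop. 3.7 (1)(2)), `Thm55Shape`
(Thm. 5.5 (2)) with finitely generated `𝒮^ac_rel`, `X^{−ε}`, `X^ac_str`. -/

/-- `Λ/(L)` is a torsion module for `L ≠ 0` in a domain. [folklore] -/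
private theorem isTorsion_quotient_span_singleton [IsDomain Λ] {L : Λ} (hL : L ≠ 0) :
    Module.IsTorsion Λ (Λ ⧸ Ideal.span {L}) :=
  fun q => ⟨⟨L, mem_nonZeroDivisors_of_ne_zero hL⟩, isTorsionBy_quotient_span_singleton L (x := q)⟩

/-- **On the signed skeleton over a Noetherian UFD, Thm. 1.7 ⟺ Thm. 3.14 (3):
`SignedMainIdentity D ↔ Thm314Shape D`** — i.e. (`X^{−ε}` torsion ∧ `Ch_Λ(X^{−ε}) = (L_{p,v_ε})`)
iff `Ch_Λ(X^ac_str) = Ch_Λ(𝒮^ac_rel/Λz)` — GIVEN Prop. 3.7 (1)(2) (`Prop37Shape`: `loc_𝔭 z`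
non-torsion, `X^ac_str` torsion), Thm. 5.5 (2) (`Thm55Shape`: `S^{−ε} = 0`), a basis `v` of `H_ε`
with `loc_𝔭 z = L·v` (Def. 4.7), and `𝒮^ac_rel`, `X^{−ε}`, `X^ac_str` finitely generated.  Proof:
(5.3)–(5.4) prime by prime (`lengthAt_thm314_iff_thm56`), the characteristic ideal determining the
height-one lengths of finite torsion modules (`SkinnerUrban2014.lengthAt_eq_of_charIdeal_eq`), and
`Ch_Λ(Λ/(L)) = (L)`.  So the K7r descent's input (R-EU) = `Thm314Shape` and the paper's headline
Thm. 1.7 are the same statement on the skeleton.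
[claim: BurungaleKobayashiNakamuraOta2026, status: under-review]
[cite: SkinnerUrban2014, §3.1.6 (p. 20)] -/
theorem signedMainIdentity_iff_thm314Shape [IsNoetherianRing Λ] [IsDomain Λ]
    [UniqueFactorizationMonoid Λ] [Module.Finite Λ Srel] [Module.Finite Λ Xneg]
    [Module.Finite Λ Xstr] {v : Hp} {L : Λ}
    (h37 : D.Prop37Shape) (h55 : D.Thm55Shape) (hv : D.IsLpOf v L) :
    D.SignedMainIdentity ↔ D.Thm314Shape := by
  have hL : L ≠ 0 := by
    intro hL0
    have h0 : (1 : Λ) • D.loc D.z = 0 := by rw [hv.2.2, hL0, zero_smul, smul_zero]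
    exact one_ne_zero (h37.1 1 h0)
  constructor
  · rintro ⟨htors, hch⟩
    have hchL : Module.charIdeal Λ Xneg = Module.charIdeal Λ (Λ ⧸ Ideal.span {L}) := by
      rw [hch, D.LpIdeal_eq_span_of_isLpOf hv]
      exact (Module.charIdeal_eq_span_of_lengthAt_eq_quotient hL fun _ _ => rfl).symm
    exact D.thm314Shape_of_lengthAt_thm56 h55.2.1 hv hL fun 𝔭 h1 =>
      SkinnerUrban2014.lengthAt_eq_of_charIdeal_eq htors (isTorsion_quotient_span_singleton hL)
        hchL 𝔭 h1
  · intro h314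
    have hZt : Module.IsTorsion Λ (Srel ⧸ Submodule.span Λ {D.z}) := fun q =>
      ⟨⟨L, mem_nonZeroDivisors_of_ne_zero hL⟩, D.isTorsionBy_quotient_span_z h55.2.1 hv (x := q)⟩
    exact D.signedMainIdentity_of_prop37_thm55_lengthAt_thm314 h37 h55 hv fun 𝔭 h1 =>
      SkinnerUrban2014.lengthAt_eq_of_charIdeal_eq h37.2.1 hZt h314 𝔭 h1

/-- The same without naming a basis (one exists by `exists_isLpOf`): on a skeleton over a
Noetherian UFD with `Prop37Shape`, `Thm55Shape` and finitely generated `𝒮^ac_rel`, `X^{−ε}`,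
`X^ac_str`, **`SignedMainIdentity D ↔ Thm314Shape D`**.
[claim: BurungaleKobayashiNakamuraOta2026, status: under-review] -/
theorem signedMainIdentity_iff_thm314Shape' [IsNoetherianRing Λ] [IsDomain Λ]
    [UniqueFactorizationMonoid Λ] [Module.Finite Λ Srel] [Module.Finite Λ Xneg]
    [Module.Finite Λ Xstr] (h37 : D.Prop37Shape) (h55 : D.Thm55Shape) :
    D.SignedMainIdentity ↔ D.Thm314Shape := by
  obtain ⟨v, L, hv⟩ := exists_isLpOf D
  exact D.signedMainIdentity_iff_thm314Shape h37 h55 hv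

end Literature.NumberTheory.EllipticCurves.BurungaleKobayashiNakamuraOta2026.SignedSkeleton

end
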